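import Literature.MathematicalPhysics.QuantumLattice.GrassmannNearIdentityStepLocal
import Literature.MathematicalPhysics.QuantumLattice.HubbardMatsubaraShellTadpole
import Literature.MathematicalPhysics.QuantumLattice.HubbardGridInteractionKernels
import Literature.MathematicalPhysics.QuantumLattice.HubbardGridCounterQuadraticL1
import HarnessLib

/-!
# The shell integration is a near-identity step: `effAction S_grid W − W` for the time-local grid vertex `W = V_N + 𝒩_{K,N}`

Topic `MathematicalPhysics/QuantumLattice`; the model instance of `GrassmannNearIdentityStepLocal` for the Matsubara SHELL covariance between two
cutoffs `M ≤ M″` (`HubbardMatsubaraCutoffBlocks.hubbardCovShellCT`) pulled back to the `N`-point time grid (`hubbardGridSub L M″ β N`, `2M″ ≤ N`)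
and the grid image of the counterterm-scheme interaction, `W = hubbardGridInteraction L N β U + hubbardGridCounterQuadratic L N β K`:

* §1 time-locality: `SameTime` (equal time index of two grid legs), `isKernelLocal_presented`, `isKernelLocal_structuredTwo`,
  **`isKernelLocal_sameTime_gridVertex`** (both pieces of `W` live on one time slice);
* §2 the `SameTime`-restricted entry bound of the shell on the grid: **`norm_gridSub_hubbardCovShellCT_le_of_sameTime`** —
  `‖(SᵀSS) A B‖ ≤ t := (4+|μ|+coeffNorm 0 K)·β/(2π²M)` below the floor (`HubbardMatsubaraShellTadpole`, charge/spin selection);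
* §3 the pinned profile of `W` (`N(2) = (|β|/N)coeffNorm 0 K`, `N(4) = |U||β|/N`, else `0`) and
  **`sum_norm_kernel_effAction_shell_sub_self_le`**: with `κ_S = √(2(M″−M)/(π(2M+1)))` (`HubbardMatsubaraShellGram`) and any `α` bounding the
  row/column sums (`HubbardMatsubaraShellRowSum`), if `θ = eα‖W‖_h/κ_S² < 1` then `Z` is a unit and, one leg pinned,
  `Σ ‖kernel (effAction (SᵀSS) W) m − kernel W m‖ ≤ [m = 2]·6·t·|U||β|/N + ρ^{-m} e‖W‖_h θ/(1−θ)` in every degree `m ≥ 1` —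
  the first-order part is the SHELL TADPOLE only (equal-time entries), NOT the `O(1)` sup entry of the shell.

Everything is proved; `SameTime` and `shellVertexProfile` are the only definitions; no named fact.

## Sources
G. Benfatto, A. Giuliani, V. Mastropietro, Ann. Henri Poincaré 7 (2006) 809–898, (2.13)–(2.14), (2.86)–(2.90) [`BenfattoGiulianiMastropietro2006`];
M. Salmhofer, *Renormalization* (1999), §4.3 (4.86)–(4.95) [`Salmhofer1999`].  The `[cite: …]` tags LOCATE the constructs; the statements are
routine instances.
-/

noncomputable section

namespace Literature.MathematicalPhysics.QuantumLattice

open GrassmannAlgebra Finset Literature.Probability.LatticeModels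
open scoped Nat

/-! ### §1 Time-locality of the grid vertex -/

section Locality

variable {𝕜 : Type*} [RCLike 𝕜] {Γ : Type*} [Fintype Γ] [DecidableEq Γ] {T : Γ → Γ → Prop}

/-- **A presented polynomial with a `T`-local coefficient is `T`-local** (the kernel is the antisymmetrisation of the coefficient).
[cite: Salmhofer1999, §4.3 (4.95)] -/
theorem isKernelLocal_presented {m : ℕ} (coef : (Fin m → Γ) → 𝕜) (hcoef : ∀ Y, coef Y ≠ 0 → ∀ i j, T (Y i) (Y j)) :
    IsKernelLocal T (presented 𝕜 coef) := by
  intro n Z h i j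
  by_cases hnm : n = m
  · subst hnm
    rw [kernel_presented] at h
    obtain ⟨σ, -, hσ⟩ := exists_ne_zero_of_sum_ne_zero (right_ne_zero_of_mul h)
    have hcσ : coef (Z ∘ σ) ≠ 0 := by
      intro h0; apply hσ; rw [h0, smul_zero]
    have := hcoef _ hcσ (σ.symm i) (σ.symm j)
    simpa only [Function.comp_apply, Equiv.apply_symm_apply] using this
  · exact absurd (kernel_presented_of_ne 𝕜 coef Z hnm) h

end Locality

section LocalityC

variable {Γ : Type*} [Fintype Γ] [DecidableEq Γ] {T : Γ → Γ → Prop}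

omit [Fintype Γ] in
/-- **A structured quadratic polynomial `Σ c_i ψ(a_i)ψ(b_i)` with `T`-related pairs is `T`-local** (`T` reflexive and symmetric on the
pairs used). [cite: Salmhofer1999, §4.3 (4.95)] -/
theorem isKernelLocal_structuredTwo {ι : Type*} (s : Finset ι) (c : ι → ℂ) (a b : ι → Γ)
    (hab : ∀ i ∈ s, T (a i) (b i) ∧ T (b i) (a i) ∧ T (a i) (a i) ∧ T (b i) (b i)) :
    IsKernelLocal T (∑ i ∈ s, c i • (gen ℂ (a i) * gen ℂ (b i))) := by
  intro n Z h p q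
  by_cases hn : n = 2
  · subst hn
    rw [kernel_sum] at h
    obtain ⟨i, hi, hci⟩ := exists_ne_zero_of_sum_ne_zero h
    rw [kernel_smul] at hci
    have hk := right_ne_zero_of_mul hci
    rw [kernel_two_gen_mul_gen] at hk
    have hk' := right_ne_zero_of_mul hk
    obtain ⟨h1, h2, h3, h4⟩ := hab i hi
    -- the nonzero bracket forces `{Z 0, Z 1} = {a i, b i}`
    have hcases : (Z 0 = a i ∧ Z 1 = b i) ∨ (Z 0 = b i ∧ Z 1 = a i) := by
      by_contra hc
      push Not at hc
      apply hk'
      have e1 : (if Z 0 = a i then (1 : ℂ) else 0) * (if Z 1 = b i then 1 else 0) = 0 := by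
        by_cases h0 : Z 0 = a i
        · rw [if_neg (hc.1 h0), mul_zero]
        · rw [if_neg h0, zero_mul]
      have e2 : (if Z 0 = b i then (1 : ℂ) else 0) * (if Z 1 = a i then 1 else 0) = 0 := by
        by_cases h0 : Z 0 = b i
        · rw [if_neg (hc.2 h0), mul_zero]
        · rw [if_neg h0, zero_mul]
      rw [e1, e2, sub_zero]
    have hZ : ∀ r : Fin 2, (Z r = a i ∨ Z r = b i) := by
      intro r
      rcases hcases with ⟨ha, hb⟩ | ⟨hb, ha⟩ <;> fin_cases r <;> simp [ha, hb]
    rcases hZ p with hp | hp <;> rcases hZ q with hq | hq <;> rw [hp, hq] <;> assumption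
  · exact absurd (kernel_two_structured_of_ne s c a b hn Z) h

end LocalityC

section Model

variable {L : ℕ} [NeZero L] {M M'' N : ℕ}

/-- **Two grid legs are on the same time slice.** [cite: Salmhofer1999, §4.2.4 (4.58)] -/
def SameTime (A B : GridLeg (GridPoint L N)) : Prop := A.1.1.1 = B.1.1.1

omit [NeZero L] in
/-- Unfolding `SameTime`. [cite: Salmhofer1999, §4.2.4 (4.58)] -/
theorem sameTime_iff (A B : GridLeg (GridPoint L N)) : SameTime A B ↔ A.1.1.1 = B.1.1.1 := Iff.rfl

/-- **The grid Hubbard vertex is time-local** (indeed point-local). [cite: Salmhofer1999, §4.2.4 (4.58)] -/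
theorem isKernelLocal_sameTime_hubbardGridInteraction (β U : ℝ) :
    IsKernelLocal (SameTime (L := L) (N := N)) (hubbardGridInteraction L N β U) := by
  classical
  rw [hubbardGridInteraction_eq_presented]
  refine isKernelLocal_presented _ fun Y hY i j => ?_
  obtain ⟨p, -, hp⟩ := exists_ne_zero_of_sum_ne_zero hY
  have hYp : Y = gridWordLegs L N p := by by_contra h; exact hp (if_neg h)
  rw [sameTime_iff, hYp, gridWordLegs_point, gridWordLegs_point]

/-- **The grid counterterm is time-local** (both legs of each monomial carry the same time index). [cite: BenfattoGiulianiMastropietro2003, §1.2 The model (2.10)] -/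
theorem isKernelLocal_sameTime_hubbardGridCounterQuadratic (β : ℝ) (K : TrigPolyC4v) :
    IsKernelLocal (SameTime (L := L) (N := N)) (hubbardGridCounterQuadratic L N β K) := by
  rw [hubbardGridCounterQuadratic_eq_sum]
  exact isKernelLocal_structuredTwo _ _ _ _ fun i _ => ⟨rfl, rfl, rfl, rfl⟩

/-- **The grid vertex `W = V_N + 𝒩_{K,N}` of the counterterm scheme is time-local.** [cite: Salmhofer1999, §4.2.4 (4.58)] -/
theorem isKernelLocal_sameTime_gridVertex (β U : ℝ) (K : TrigPolyC4v) :
    IsKernelLocal (SameTime (L := L) (N := N)) (hubbardGridInteraction L N β U + hubbardGridCounterQuadratic L N β K) :=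
  (isKernelLocal_sameTime_hubbardGridInteraction β U).add (isKernelLocal_sameTime_hubbardGridCounterQuadratic β K)

/-! ### §2 The equal-time entry bound of the shell on the regular grid -/

/-- **On the same time slice every entry of the pulled-back shell covariance is `≤ t = (4+|μ|+coeffNorm 0 K)·β/(2π²M)`** (below the floor;
different spins or equal charges give `0`). [cite: BenfattoGiulianiMastropietro2006, §2.2 (2.14)] -/
theorem norm_gridSub_hubbardCovShellCT_le_of_sameTime {β : ℝ} (hβ : 0 < β) (hM : 1 ≤ M) (h : M ≤ M'') (μ : ℝ) (K : TrigPolyC4v)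
    {Λ : ℝ} (hΛ : 0 < Λ) (hΛle : Λ ≤ Real.pi * (2 * M + 1) / β) {A B : GridLeg (GridPoint L N)} (hAB : SameTime A B) :
    ‖((hubbardGridSub L M'' β N).transpose * hubbardCovShellCT L h β μ 0 K Λ * hubbardGridSub L M'' β N) A B‖ ≤
      (4 + |μ| + K.coeffNorm 0) * β / (2 * Real.pi ^ 2 * M) := by
  have ht0 : 0 ≤ (4 + |μ| + K.coeffNorm 0) * β / (2 * Real.pi ^ 2 * M) := by
    have := TrigPolyC4v.coeffNorm_nonneg 0 K; positivity
  obtain ⟨⟨a, σ⟩, c⟩ := A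
  obtain ⟨⟨b, σ'⟩, c'⟩ := B
  have hab : a.1 = b.1 := hAB
  have hτ : (fun p : GridPoint L N => gridTime β N p.1) a = (fun p : GridPoint L N => gridTime β N p.1) b := by
    show gridTime β N a.1 = gridTime β N b.1
    rw [hab]
  set x : GridPoint L N → TorusSite 2 L := fun p => p.2 with hx
  set τ : GridPoint L N → ℝ := fun p => gridTime β N p.1 with hτdef
  have hS : hubbardGridSub L M'' β N = gridSubMatrix L M'' β x τ := rfl
  rw [hS]
  by_cases hcc : c = c'
  · rw [hubbardCovShellCT_zero_seed, gridSub_pullback_normalCovariance_apply_of_charge_eq β x τ _ (Y := ((a, σ), c)) (Y' := ((b, σ'), c')) hcc,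
      norm_zero]
    exact ht0
  by_cases hσ : σ = σ'
  · subst hσ
    have hc2 : (c = 0 ∧ c' = 1) ∨ (c = 1 ∧ c' = 0) := by
      rcases Fin.exists_fin_two.1 ⟨c, rfl⟩ with hc | hc <;> rcases Fin.exists_fin_two.1 ⟨c', rfl⟩ with hc' | hc' <;> simp_all
    rcases hc2 with ⟨hc, hc'⟩ | ⟨hc, hc'⟩
    · rw [hc, hc']
      exact norm_gridSub_hubbardCovShellCT_apply_equalTime_le hβ hM h μ K hΛ hΛle x τ (a := a) (b := b) hτ σ
    · rw [hc, hc']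
      exact norm_gridSub_hubbardCovShellCT_apply_equalTime_le' hβ hM h μ K hΛ hΛle x τ (a := a) (b := b) hτ σ
  · -- different spins: the entry vanishes
    have hc2 : (c = 0 ∧ c' = 1) ∨ (c = 1 ∧ c' = 0) := by
      rcases Fin.exists_fin_two.1 ⟨c, rfl⟩ with hc | hc <;> rcases Fin.exists_fin_two.1 ⟨c', rfl⟩ with hc' | hc' <;> simp_all
    have h0 : ((gridSubMatrix L M'' β x τ).transpose * hubbardCovShellCT L h β μ 0 K Λ * gridSubMatrix L M'' β x τ) ((a, σ), c) ((b, σ'), c') = 0 := by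
      rw [hubbardCovShellCT_zero_seed]
      rcases hc2 with ⟨hc, hc'⟩ | ⟨hc, hc'⟩
      · rw [hc, hc', gridSub_pullback_normalCovariance_apply_zero_one, if_neg hσ]
      · rw [hc, hc', gridSub_pullback_normalCovariance_apply_one_zero, gridSub_pullback_normalCovariance_apply_zero_one, if_neg (Ne.symm hσ),
          neg_zero]
    rw [h0, norm_zero]
    exact ht0

/-! ### §3 The shell integration of the grid vertex is a near-identity step -/

variable (N) in
/-- The pinned-norm profile of the grid vertex: `(|β|/N)·coeffNorm 0 K` in degree `2`, `|U|·|β|/N` in degree `4`, `0` otherwise.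
[cite: BenfattoGiulianiMastropietro2006, (2.13)-(2.14)] -/
def shellVertexProfile (β U : ℝ) (K : TrigPolyC4v) (n : ℕ) : ℝ :=
  if n = 4 then |U| * |β| / N else if n = 2 then |β| / N * K.coeffNorm 0 else 0

omit [NeZero L] in
/-- The profile is nonnegative. [cite: BenfattoGiulianiMastropietro2006, (2.13)-(2.14)] -/
theorem shellVertexProfile_nonneg (β U : ℝ) (K : TrigPolyC4v) (n : ℕ) : 0 ≤ shellVertexProfile N β U K n := by
  have := TrigPolyC4v.coeffNorm_nonneg 0 K
  unfold shellVertexProfile; split_ifs <;> positivity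

/-- **The pinned kernel norms of the grid vertex are bounded by the profile**, in every degree and slot. [cite: BenfattoGiulianiMastropietro2006, (2.13)-(2.14)] -/
theorem sum_norm_kernel_gridVertex_le (β U : ℝ) (K : TrigPolyC4v) (n : ℕ) (p : Fin n) (w : GridLeg (GridPoint L N)) :
    ∑ Z ∈ univ.filter (fun Z : Fin n → GridLeg (GridPoint L N) => Z p = w),
        ‖kernel ℂ (hubbardGridInteraction L N β U + hubbardGridCounterQuadratic L N β K) n Z‖ ≤ shellVertexProfile N β U K n := by
  simp_rw [kernel_add]
  by_cases h4 : n = 4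
  · subst h4
    rw [shellVertexProfile, if_pos rfl]
    refine le_trans (sum_le_sum fun Z _ => ?_) (sum_norm_kernel_hubbardGridInteraction_le (L := L) (N := N) β U p w)
    rw [kernel_hubbardGridCounterQuadratic_of_ne β K (by norm_num) Z, add_zero]
  by_cases h2 : n = 2
  · subst h2
    rw [shellVertexProfile, if_neg h4, if_pos rfl]
    refine le_trans (sum_le_sum fun Z _ => ?_) (sum_norm_kernel_hubbardGridCounterQuadratic_le (L := L) (N := N) β K p w)
    rw [kernel_hubbardGridInteraction_of_ne (L := L) (N := N) β U (by norm_num) Z, zero_add]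
  · rw [shellVertexProfile, if_neg h4, if_neg h2]
    refine (sum_eq_zero fun Z _ => ?_).le
    rw [kernel_hubbardGridInteraction_of_ne (L := L) (N := N) β U h4 Z, kernel_hubbardGridCounterQuadratic_of_ne β K h2 Z, add_zero, norm_zero]

/-- The grid counterterm is even (re-derived at the Literature level; the Summits twin is `EngineV8.hubbardGridCounterQuadratic_mem_evenPart`).
[cite: BenfattoGiulianiMastropietro2003, §1.2 The model (2.10)] -/
theorem hubbardGridCounterQuadratic_mem_evenPart_lit (β : ℝ) (K : TrigPolyC4v) :
    hubbardGridCounterQuadratic L N β K ∈ evenPart ℂ (GridLeg (GridPoint L N)) := by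
  rw [hubbardGridCounterQuadratic_eq_sum, mem_evenPart_iff]
  refine Submodule.sum_mem _ fun i _ => Submodule.smul_mem _ _ ?_
  exact CliffordAlgebra.ι_mul_ι_mem_evenOdd_zero _ _ _

/-- **The first-order (tadpole) sum collapses**: with the grid-vertex profile only the term `(m, j) = (2, 1)` survives in degrees `m ≥ 1`:
`Σ_{1 ≤ j < k} ((m+2j)!/(m! j! 2^j)) t^j N(m+2j) ≤ [m = 2]·6·t·|U||β|/N` (`t ≥ 0`). [cite: BenfattoGiulianiMastropietro2006, (2.86)-(2.90)] -/
theorem sum_tadpole_shellVertexProfile_le (β U : ℝ) (K : TrigPolyC4v) {t : ℝ} (ht : 0 ≤ t) (k : ℕ) {m : ℕ} (hm : 0 < m) :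
    ∑ j ∈ Ico 1 k, ((m + 2 * j)! : ℝ) / ((m ! : ℝ) * (j ! : ℝ) * 2 ^ j) * t ^ j * shellVertexProfile N β U K (m + 2 * j) ≤
      if m = 2 then 6 * t * (|U| * |β| / N) else 0 := by
  have hterm : ∀ j ∈ Ico 1 k, ((m + 2 * j)! : ℝ) / ((m ! : ℝ) * (j ! : ℝ) * 2 ^ j) * t ^ j * shellVertexProfile N β U K (m + 2 * j) =
      if j = 1 ∧ m = 2 then 6 * t * (|U| * |β| / N) else 0 := by
    intro j hj
    have hj1 : 1 ≤ j := (mem_Ico.1 hj).1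
    by_cases hjm : j = 1 ∧ m = 2
    · obtain ⟨rfl, rfl⟩ := hjm
      rw [if_pos ⟨rfl, rfl⟩, shellVertexProfile, if_pos (by norm_num)]
      norm_num [Nat.factorial]
    · rw [if_neg hjm, shellVertexProfile, if_neg (by omega), if_neg (by omega), mul_zero]
  rw [sum_congr rfl hterm]
  by_cases hm2 : m = 2
  · subst hm2
    simp only [and_true, if_true]
    rw [sum_ite_eq' (Ico 1 k) 1]
    split_ifs
    · exact le_rfl
    · positivity
  · simp only [hm2, and_false, if_false, sum_const_zero, le_refl]

/-- **THE SHELL INTEGRATION IS A NEAR-IDENTITY STEP** for the grid vertex `W = V_N + 𝒩_{K,N}` of the counterterm scheme: with the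
Matsubara shell covariance `S` of two cutoffs `M ≤ M″` pulled back to the `N`-grid (`1 ≤ M < M″`, `0 < Λ ≤ π(2M+1)/β`), Gram constant
`κ_S = √(2(M″−M)/(π(2M+1)))`, row/column sums `≤ α` and `θ = eα‖W‖_h/κ_S² < 1`, in every degree `m ≥ 1` and at every pinned leg:
`Σ ‖kernel (effAction (SᵀSS) W) m − kernel W m‖ ≤ [m = 2]·6·t·|U||β|/N + ρ^{-m}·e‖W‖_h·θ/(1−θ)`, `t = (4+|μ|+coeffNorm 0 K)β/(2π²M)` —
the first-order part is the shell TADPOLE, `O(|U|β²/(MN))`. [cite: BenfattoGiulianiMastropietro2006, (2.86)-(2.90)] -/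
theorem sum_norm_kernel_effAction_shell_sub_self_le [NeZero N] {β : ℝ} (hβ : 0 < β) (hM : 1 ≤ M) (h : M ≤ M'') (U μ : ℝ)
    (K : TrigPolyC4v) {Λ : ℝ} (hΛ : 0 < Λ) (hΛle : Λ ≤ Real.pi * (2 * M + 1) / β) (hMM : M < M'')
    {α : ℝ} (hα : 0 < α)
    (hrow : ∀ X, ∑ Y, ‖((hubbardGridSub L M'' β N).transpose * hubbardCovShellCT L h β μ 0 K Λ * hubbardGridSub L M'' β N) X Y‖ ≤ α)
    (hcol : ∀ Y, ∑ X, ‖((hubbardGridSub L M'' β N).transpose * hubbardCovShellCT L h β μ 0 K Λ * hubbardGridSub L M'' β N) X Y‖ ≤ α)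
    {ρ : ℝ} (hρ : 0 < ρ)
    (hθ : Real.exp 1 * α * normV (GridLeg (GridPoint L N)) (Real.sqrt (2 * ((M'' : ℝ) - M) / (Real.pi * (2 * M + 1)))) ρ
        (fun m' => shellVertexProfile N β U K (2 * m')) / Real.sqrt (2 * ((M'' : ℝ) - M) / (Real.pi * (2 * M + 1))) ^ 2 < 1) :
    IsUnit (effPartitionFn ℂ ((hubbardGridSub L M'' β N).transpose * hubbardCovShellCT L h β μ 0 K Λ * hubbardGridSub L M'' β N)
        (hubbardGridInteraction L N β U + hubbardGridCounterQuadratic L N β K)) ∧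
      ∀ {m : ℕ}, 0 < m → ∀ (i : Fin m) (w : GridLeg (GridPoint L N)),
        ∑ X ∈ univ.filter (fun X : Fin m → GridLeg (GridPoint L N) => X i = w),
            ‖kernel ℂ (effAction ℂ ((hubbardGridSub L M'' β N).transpose * hubbardCovShellCT L h β μ 0 K Λ * hubbardGridSub L M'' β N)
                (hubbardGridInteraction L N β U + hubbardGridCounterQuadratic L N β K)) m X -
              kernel ℂ (hubbardGridInteraction L N β U + hubbardGridCounterQuadratic L N β K) m X‖ ≤
          (if m = 2 then 6 * ((4 + |μ| + K.coeffNorm 0) * β / (2 * Real.pi ^ 2 * M)) * (|U| * |β| / N) else 0) +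
            ρ⁻¹ ^ m * (Real.exp 1 * normV (GridLeg (GridPoint L N)) (Real.sqrt (2 * ((M'' : ℝ) - M) / (Real.pi * (2 * M + 1)))) ρ
                (fun m' => shellVertexProfile N β U K (2 * m'))) *
              (Real.exp 1 * α * normV (GridLeg (GridPoint L N)) (Real.sqrt (2 * ((M'' : ℝ) - M) / (Real.pi * (2 * M + 1)))) ρ
                  (fun m' => shellVertexProfile N β U K (2 * m')) / Real.sqrt (2 * ((M'' : ℝ) - M) / (Real.pi * (2 * M + 1))) ^ 2) /
                (1 - Real.exp 1 * α * normV (GridLeg (GridPoint L N)) (Real.sqrt (2 * ((M'' : ℝ) - M) / (Real.pi * (2 * M + 1)))) ρ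
                  (fun m' => shellVertexProfile N β U K (2 * m')) / Real.sqrt (2 * ((M'' : ℝ) - M) / (Real.pi * (2 * M + 1))) ^ 2) := by
  set C := (hubbardGridSub L M'' β N).transpose * hubbardCovShellCT L h β μ 0 K Λ * hubbardGridSub L M'' β N with hC
  set W := hubbardGridInteraction L N β U + hubbardGridCounterQuadratic L N β K with hW
  set t : ℝ := (4 + |μ| + K.coeffNorm 0) * β / (2 * Real.pi ^ 2 * M) with htdef
  have ht0 : 0 ≤ t := by rw [htdef]; have := TrigPolyC4v.coeffNorm_nonneg 0 K; positivity
  have hκ : 0 < Real.sqrt (2 * ((M'' : ℝ) - M) / (Real.pi * (2 * M + 1))) := by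
    apply Real.sqrt_pos.2
    have : (M : ℝ) < M'' := by exact_mod_cast hMM
    apply div_pos <;> nlinarith [Real.pi_pos]
  have hGB : IsGramBoundedR C (Real.sqrt (2 * ((M'' : ℝ) - M) / (Real.pi * (2 * M + 1)))) := by
    rw [hC, hubbardGridSub]; exact isGramBoundedR_gridSub_hubbardCovShellCT hβ h μ K Λ _ _
  have hWeven : W ∈ evenPart ℂ (GridLeg (GridPoint L N)) :=
    add_mem (hubbardGridInteraction_mem_evenPart β U) (hubbardGridCounterQuadratic_mem_evenPart_lit β K)
  have hW0 : constPart ℂ W = 0 := by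
    rw [hW, map_add, constPart_hubbardGridInteraction, constPart_hubbardGridCounterQuadratic, add_zero]
  have hloc : IsKernelLocal (SameTime (L := L) (N := N)) W := isKernelLocal_sameTime_gridVertex β U K
  have ht : ∀ A B : GridLeg (GridPoint L N), SameTime A B → ‖C A B‖ ≤ t := fun A B hAB =>
    norm_gridSub_hubbardCovShellCT_le_of_sameTime hβ hM h μ K hΛ hΛle hAB
  obtain ⟨k, hk⟩ := isNilpotent_grassmannLaplacian ℂ C
  obtain ⟨hunit, hbd⟩ := sum_norm_kernel_effAction_sub_self_le_of_local C hκ hGB W hWeven hW0 hloc (shellVertexProfile N β U K)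
    (shellVertexProfile_nonneg β U K) (sum_norm_kernel_gridVertex_le β U K) hα hrow hcol hρ hθ ht0 ht hk
  refine ⟨hunit, @fun m hm i w => (hbd hm i w).trans (add_le_add (sum_tadpole_shellVertexProfile_le β U K ht0 k hm) le_rfl)⟩

end Model

end Literature.MathematicalPhysics.QuantumLattice
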